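import Summits.SmoothPoincare4.SmoothPoincare4.Theorems.SblfDescentRungOneHelperBottFlowODE
import Summits.SmoothPoincare4.SmoothPoincare4.Theorems.SblfDescentRungOneHelperFoldNFDescend
import Literature.Topology.FourManifolds.CircleSurgeryExistence
import Literature.Topology.FourManifolds.KnotFraming
import Literature.Topology.FourManifolds.Morse
import Mathlib.Geometry.Manifold.ContMDiff.Atlas
import Mathlib.Geometry.Manifold.MFDeriv.Atlas
import HarnessLib

/-!
# The height family along a straightened tube about a Morse–Bott circle (tube layer, part A)

Auxiliary file of helper `helper_bott_tube` of stub `helper_sliceGluing_bottRecognition` (fibred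
Morse–Bott recognition of the polar tube), line `Sketch`, crux `SblfDescent.RungOne`.

(Crux item stmt-SmoothPoincare4-18531; skeleton `Cruxes/RungOne/Lines/Sketch.lean`.)

Setting (`BottTube.TSetup`): a smooth `4`-manifold `X`, a smooth `F : X → ℝ` with a circle
`e(𝕊¹)` of critical points at the level `b`, a tube `ν₀ : 𝕊¹ × ℝ³ ↪ X` about it, and an
equivariant tube reparametrisation `Φ₁` of `ℝ × B(0, ε₁)` (fixing the zero section, with
equivariant left inverse `Ψ₁`; the output of the periodic tube inverse function theorem
`helper_foldNF_tubeIFT`).  The **height family**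
`g (t, y) = b - F (ν₀ (circlePt (Φ₁ (t, κ y)).1, (Φ₁ (t, κ y)).2))`, where `κ` shrinks `ℝ³` into
`B(0, ε₁/2)` and is the identity near `0` (the profile of `BottFlow.exists_profile`), is smooth
on all of `ℝ × ℝ³`, `1`-periodic in `t`, vanishes on the zero section and is critical there
(`BottTube.TSetup.contDiff_g`, `g_add_one`, `g_zero`, `fderiv_g`).  For the Hessian
computation of part B we also record the lifted tube `Θ₀ = ν₀ ∘ (circlePt × id) ∘ Φ₁` and the
injectivity of its differential along the zero section read in a chart
(`injective_fderiv_chart_Θ₀`: it has the smooth local left inverse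
`Ψ₁ ∘ (ang × id) ∘ ν₀⁻¹ ∘ chart⁻¹`, `ang` a local section of `circlePt`).

## References

* A. Banyaga, D. E. Hurtubise, *A proof of the Morse–Bott Lemma*, Expo. Math. 22 (2004), Thm. 2.
  [BanyagaHurtubise2004]
* J. Milnor, *Morse theory* (1963), §2. [Milnor1963]
-/

set_option linter.dupNamespace false

noncomputable section

open scoped Manifold ContDiff Topology
open Set Function Filter Metric Literature.Topology.FourManifolds

namespace Summit.SmoothPoincare4.SmoothPoincare4.Cruxes.RungOne.Sketch

namespace BottTube

/-- **The data of the tube layer** (see the module docstring). [folklore] -/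
structure TSetup (X : Type) [TopologicalSpace X] [ChartedSpace (EuclideanSpace ℝ (Fin 4)) X]
    [IsManifold (𝓡 4) ∞ X] where
  /-- the Morse–Bott function -/
  F : X → ℝ
  /-- the critical value -/
  b : ℝ
  /-- the critical circle -/
  e : Metric.sphere (0 : EuclideanSpace ℝ (Fin 2)) 1 → X
  /-- a tube about it -/
  ν₀ : CircleNbhd (𝓡 4) e
  /-- the tube reparametrisation and its left inverse -/
  Φ₁ : ℝ × EuclideanSpace ℝ (Fin 3) → ℝ × EuclideanSpace ℝ (Fin 3)
  /-- the left inverse -/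
  Ψ₁ : ℝ × EuclideanSpace ℝ (Fin 3) → ℝ × EuclideanSpace ℝ (Fin 3)
  /-- the radii -/
  ε₁ : ℝ
  /-- the radius of the left inverse -/
  r₁ : ℝ
  hε₁ : 0 < ε₁
  hr₁ : 0 < r₁
  hF : ContMDiff (𝓡 4) 𝓘(ℝ, ℝ) ∞ F
  hFe : ∀ u, F (e u) = b
  hcrit : ∀ u, IsMCriticalPt (𝓡 4) F (e u)
  hbott : ∀ (u : Metric.sphere (0 : EuclideanSpace ℝ (Fin 2)) 1) (w : EuclideanSpace ℝ (Fin 4)),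
    mhessian (𝓡 4) F (e u) w w ≤ 0 ∧
      (mhessian (𝓡 4) F (e u) w w = 0 → w ∈ range (mfderiv (𝓡 1) (𝓡 4) e u))
  hΦ₁ : ContDiffOn ℝ ∞ Φ₁ (univ ×ˢ ball 0 ε₁)
  hΨ₁ : ContDiffOn ℝ ∞ Ψ₁ (univ ×ˢ ball 0 r₁)
  hΦ₁0 : ∀ t : ℝ, Φ₁ (t, 0) = (t, 0)
  hΦ₁per : ∀ (s : ℝ) (y : EuclideanSpace ℝ (Fin 3)), y ∈ ball (0 : EuclideanSpace ℝ (Fin 3)) ε₁ →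
    Φ₁ (s + 1, y) = Φ₁ (s, y) + (1, 0)
  hinv : ∀ q ∈ univ ×ˢ ball (0 : EuclideanSpace ℝ (Fin 3)) ε₁,
    Φ₁ q ∈ univ ×ˢ ball (0 : EuclideanSpace ℝ (Fin 3)) r₁ ∧ Ψ₁ (Φ₁ q) = q

namespace TSetup

variable {X : Type} [TopologicalSpace X] [ChartedSpace (EuclideanSpace ℝ (Fin 4)) X]
  [IsManifold (𝓡 4) ∞ X] (D : TSetup X)

/-! ### The shrinking map `κ` -/

/-- The scale `s₀ = ε₁²/8`. [folklore] -/
def s₀ : ℝ := D.ε₁ ^ 2 / 8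

/-- The scale is positive, together with `ε₁ > 0` (packaged). [folklore] -/
theorem s₀_pos_and : 0 < D.s₀ ∧ 0 < D.ε₁ := ⟨by have := D.hε₁; unfold s₀; positivity, D.hε₁⟩

/-- The profile `λ` at the scale `s₀` (a choice). [folklore] -/
def lam : ℝ → ℝ := Classical.choose (BottFlow.exists_profile D.s₀_pos_and.1)

/-- `λ` is smooth, `= 1` below `s₀`, `≥ 1`, `s/λ(s) ≤ 2 s₀`, and positive. [folklore] -/
theorem lam_spec : (ContDiff ℝ ∞ D.lam ∧ (∀ s, s ≤ D.s₀ → D.lam s = 1) ∧ (∀ s, 1 ≤ D.lam s) ∧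
    ∀ s, s / D.lam s ≤ 2 * D.s₀) ∧ ∀ s, 0 < D.lam s :=
  ⟨Classical.choose_spec (BottFlow.exists_profile D.s₀_pos_and.1), fun s =>
    lt_of_lt_of_le one_pos ((Classical.choose_spec (BottFlow.exists_profile D.s₀_pos_and.1)).2.2.1 s)⟩

/-- **The shrinking map** `κ y = y / √λ(‖y‖²)`. [folklore] -/
def κ (y : EuclideanSpace ℝ (Fin 3)) : EuclideanSpace ℝ (Fin 3) := (√(D.lam (‖y‖ ^ 2)))⁻¹ • y

/-- `κ` is smooth. [folklore] -/
theorem contDiff_κ : ContDiff ℝ ∞ D.κ := by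
  have h1 : ContDiff ℝ ∞ fun y : EuclideanSpace ℝ (Fin 3) => D.lam (‖y‖ ^ 2) :=
    D.lam_spec.1.1.comp (contDiff_norm_sq ℝ)
  exact ((h1.sqrt fun y => (D.lam_spec.2 _).ne').inv
    fun y => (Real.sqrt_pos.2 (D.lam_spec.2 _)).ne').smul contDiff_id

/-- `‖κ y‖ < ε₁`. [folklore] -/
theorem norm_κ_lt (y : EuclideanSpace ℝ (Fin 3)) : ‖D.κ y‖ < D.ε₁ := by
  have h1 : ‖D.κ y‖ ^ 2 = ‖y‖ ^ 2 / D.lam (‖y‖ ^ 2) := by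
    rw [κ, norm_smul, mul_pow, norm_inv, inv_pow, Real.norm_eq_abs, sq_abs,
      Real.sq_sqrt (D.lam_spec.2 _).le]
    ring
  have h2 : ‖D.κ y‖ ^ 2 < D.ε₁ ^ 2 := by
    rw [h1]
    have := D.lam_spec.1.2.2.2 (‖y‖ ^ 2)
    have hε := D.hε₁
    unfold s₀ at this
    nlinarith
  exact (pow_lt_pow_iff_left₀ (norm_nonneg _) D.hε₁.le two_ne_zero).1 h2

/-- `κ y` lies in the tube. [folklore] -/
theorem κ_mem (t : ℝ) (y : EuclideanSpace ℝ (Fin 3)) :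
    ((t, D.κ y) : ℝ × EuclideanSpace ℝ (Fin 3)) ∈ univ ×ˢ ball (0 : EuclideanSpace ℝ (Fin 3)) D.ε₁ :=
  mk_mem_prod (mem_univ t) (mem_ball_zero_iff.2 (D.norm_κ_lt y))

/-- `κ = id` on `‖y‖² ≤ s₀`. [folklore] -/
theorem κ_eq_self {y : EuclideanSpace ℝ (Fin 3)} (hy : ‖y‖ ^ 2 ≤ D.s₀) : D.κ y = y := by
  rw [κ, D.lam_spec.1.2.1 _ hy, Real.sqrt_one, inv_one, one_smul]

/-- `κ 0 = 0`. [folklore] -/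
theorem κ_zero : D.κ 0 = 0 := D.κ_eq_self (by rw [norm_zero, zero_pow two_ne_zero]; exact D.s₀_pos_and.1.le)

/-- `κ = id` near `0`. [folklore] -/
theorem κ_eventuallyEq (t : ℝ) :
    ∀ᶠ q : ℝ × EuclideanSpace ℝ (Fin 3) in 𝓝 (t, 0), D.κ q.2 = q.2 := by
  have ho : IsOpen {q : ℝ × EuclideanSpace ℝ (Fin 3) | ‖q.2‖ ^ 2 < D.s₀} :=
    isOpen_lt ((continuous_norm.comp continuous_snd).pow 2) continuous_const
  filter_upwards [ho.mem_nhds (show ‖(0 : EuclideanSpace ℝ (Fin 3))‖ ^ 2 < D.s₀ by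
    rw [norm_zero, zero_pow two_ne_zero]; exact D.s₀_pos_and.1)] with q hq
  exact D.κ_eq_self (le_of_lt hq)

/-! ### The lifted tubes and the height family -/

/-- The lifted tube `Θ₀ = ν₀ ∘ (circlePt × id) ∘ Φ₁`. [folklore] -/
def Θ₀ (q : ℝ × EuclideanSpace ℝ (Fin 3)) : X := D.ν₀.toFun (circlePt (D.Φ₁ q).1, (D.Φ₁ q).2)

/-- The globally defined lifted tube `Θ (t, y) = Θ₀ (t, κ y)`. [folklore] -/
def Θ (q : ℝ × EuclideanSpace ℝ (Fin 3)) : X := D.Θ₀ (q.1, D.κ q.2)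

/-- **The height family** `g (t, y) = b - F (Θ (t, y))`. [folklore] -/
def g (q : ℝ × EuclideanSpace ℝ (Fin 3)) : ℝ := D.b - D.F (D.Θ q)

/-- `Θ₀` is smooth on the tube. [folklore] -/
theorem contMDiffOn_Θ₀ : ContMDiffOn 𝓘(ℝ, ℝ × EuclideanSpace ℝ (Fin 3)) (𝓡 4) ∞ D.Θ₀
    (univ ×ˢ ball (0 : EuclideanSpace ℝ (Fin 3)) D.ε₁) := by
  have h1 : ContMDiffOn 𝓘(ℝ, ℝ × EuclideanSpace ℝ (Fin 3)) 𝓘(ℝ, ℝ × EuclideanSpace ℝ (Fin 3)) ∞ D.Φ₁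
      (univ ×ˢ ball (0 : EuclideanSpace ℝ (Fin 3)) D.ε₁) := contMDiffOn_iff_contDiffOn.2 D.hΦ₁
  exact (D.ν₀.contMDiff.comp contMDiff_circlePt_prod).comp_contMDiffOn h1

/-- `Θ` is smooth. [folklore] -/
theorem contMDiff_Θ : ContMDiff 𝓘(ℝ, ℝ × EuclideanSpace ℝ (Fin 3)) (𝓡 4) ∞ D.Θ := by
  have hk : ContMDiff 𝓘(ℝ, ℝ × EuclideanSpace ℝ (Fin 3)) 𝓘(ℝ, ℝ × EuclideanSpace ℝ (Fin 3)) ∞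
      fun q : ℝ × EuclideanSpace ℝ (Fin 3) => ((q.1, D.κ q.2) : ℝ × EuclideanSpace ℝ (Fin 3)) :=
    (contDiff_fst.prodMk (D.contDiff_κ.comp contDiff_snd)).contMDiff
  exact D.contMDiffOn_Θ₀.comp_contMDiff hk fun q => D.κ_mem q.1 q.2

/-- **The height family is smooth.** [folklore] -/
theorem contDiff_g : ContDiff ℝ ∞ D.g := by
  have h : ContMDiff 𝓘(ℝ, ℝ × EuclideanSpace ℝ (Fin 3)) 𝓘(ℝ, ℝ) ∞ fun q => D.F (D.Θ q) :=
    D.hF.comp D.contMDiff_Θ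
  rw [contMDiff_iff_contDiff] at h
  exact contDiff_const.sub h

/-- `Θ = Θ₀` near the zero section. [folklore] -/
theorem Θ_eventuallyEq (t : ℝ) : D.Θ =ᶠ[𝓝 (t, 0)] D.Θ₀ := by
  filter_upwards [D.κ_eventuallyEq t] with q hq
  rw [Θ, hq]

/-- `Θ₀ (s, 0) = e (circlePt s)`. [folklore] -/
theorem Θ₀_zero (s : ℝ) : D.Θ₀ (s, 0) = D.e (circlePt s) := by
  simp [Θ₀, D.hΦ₁0, D.ν₀.apply_zero]

/-- `Θ (s, 0) = e (circlePt s)`. [folklore] -/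
theorem Θ_zero (s : ℝ) : D.Θ (s, 0) = D.e (circlePt s) := by
  rw [Θ, D.κ_zero]; exact D.Θ₀_zero s

/-- **The height family is `1`-periodic.** [folklore] -/
theorem g_add_one (t : ℝ) (y : EuclideanSpace ℝ (Fin 3)) : D.g (t + 1, y) = D.g (t, y) := by
  simp only [g, Θ, Θ₀]
  rw [D.hΦ₁per t (D.κ y) (mem_ball_zero_iff.2 (D.norm_κ_lt y)), Prod.fst_add, Prod.snd_add,
    add_zero, circlePt_add_one]

/-- **The height family vanishes on the zero section.** [folklore] -/
theorem g_zero (t : ℝ) : D.g (t, 0) = 0 := by rw [g, D.Θ_zero, D.hFe, sub_self]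

/-- **The zero section is critical for the height family**: `dg (t, 0) = 0`. [folklore] -/
theorem fderiv_g (t : ℝ) : fderiv ℝ D.g (t, 0) = 0 := by
  have hn : (∞ : WithTop ℕ∞) ≠ 0 := by simp
  have hΘd : MDifferentiableAt 𝓘(ℝ, ℝ × EuclideanSpace ℝ (Fin 3)) (𝓡 4) D.Θ (t, 0) :=
    (D.contMDiff_Θ _).mdifferentiableAt hn
  have hFd : MDifferentiableAt (𝓡 4) 𝓘(ℝ, ℝ) D.F (D.Θ (t, 0)) := (D.hF _).mdifferentiableAt hn
  have hcomp := mfderiv_comp (t, 0) hFd hΘd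
  have hc : mfderiv (𝓡 4) 𝓘(ℝ, ℝ) D.F (D.Θ (t, 0)) = 0 := by
    rw [D.Θ_zero]; exact D.hcrit _
  rw [hc, ContinuousLinearMap.zero_comp, mfderiv_eq_fderiv] at hcomp
  have h3 : fderiv ℝ (D.F ∘ D.Θ) (t, 0) = 0 := hcomp
  have h2 : fderiv ℝ D.g (t, 0) = -fderiv ℝ (D.F ∘ D.Θ) (t, 0) := by
    show fderiv ℝ (fun q => D.b - (D.F ∘ D.Θ) q) (t, 0) = _
    exact fderiv_const_sub _
  rw [h2, h3, neg_zero]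

/-! ### The differential of `Θ₀` along the zero section, in a chart -/

/-- The circle is smooth (`e = ν₀ (·, 0)`). [folklore] -/
theorem contMDiff_e : ContMDiff (𝓡 1) (𝓡 4) ∞ D.e := by
  have h : D.e = fun u => D.ν₀.toFun (u, 0) := funext fun u => (D.ν₀.apply_zero u).symm
  rw [h]
  exact D.ν₀.contMDiff.comp (contMDiff_id.prodMk contMDiff_const)

/-- `Θ₀` is smooth at the points of the zero section. [folklore] -/
theorem contMDiffAt_Θ₀ (t : ℝ) : ContMDiffAt 𝓘(ℝ, ℝ × EuclideanSpace ℝ (Fin 3)) (𝓡 4) ∞ D.Θ₀ (t, 0) :=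
  D.contMDiffOn_Θ₀.contMDiffAt ((isOpen_univ.prod isOpen_ball).mem_nhds
    (mk_mem_prod (mem_univ t) (mem_ball_self D.hε₁)))

/-- **The lifted tube read in the chart at `e (circlePt t)` has injective differential at
`(t, 0)`**: it has the smooth local left inverse `Ψ₁ ∘ (ang × id) ∘ ν₀⁻¹ ∘ chart⁻¹`.
[folklore] -/
theorem injective_fderiv_chart_Θ₀ (t : ℝ) :
    Injective (fderiv ℝ (fun q => extChartAt (𝓡 4) (D.e (circlePt t)) (D.Θ₀ q)) (t, 0)) := by
  set x₀ := D.e (circlePt t) with hx₀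
  set φ := extChartAt (𝓡 4) x₀ with hφ
  set A : ℝ × EuclideanSpace ℝ (Fin 3) → EuclideanSpace ℝ (Fin 4) := fun q => φ (D.Θ₀ q) with hA
  obtain ⟨ang, hang, hsec⟩ := exists_local_section_circlePt t
  set B : EuclideanSpace ℝ (Fin 4) → ℝ × EuclideanSpace ℝ (Fin 3) := fun p =>
    D.Ψ₁ (ang (D.ν₀.toHomeo.symm (φ.symm p)).1, (D.ν₀.toHomeo.symm (φ.symm p)).2) with hB
  have h0 : D.Θ₀ (t, 0) = x₀ := D.Θ₀_zero t
  -- smoothness of `A` at `(t, 0)`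
  have hAs : ContMDiffAt 𝓘(ℝ, ℝ × EuclideanSpace ℝ (Fin 3)) 𝓘(ℝ, EuclideanSpace ℝ (Fin 4)) ∞ A (t, 0) := by
    have h1 : ContMDiffAt (𝓡 4) 𝓘(ℝ, EuclideanSpace ℝ (Fin 4)) ∞ φ (D.Θ₀ (t, 0)) := by
      rw [h0]; exact contMDiffAt_extChartAt
    exact h1.comp (t, 0) (D.contMDiffAt_Θ₀ t)
  -- smoothness of `B` at `A (t, 0) = φ x₀`
  have hA0 : A (t, 0) = φ x₀ := by simp only [hA, h0]
  have hBs : ContMDiffAt 𝓘(ℝ, EuclideanSpace ℝ (Fin 4)) 𝓘(ℝ, ℝ × EuclideanSpace ℝ (Fin 3)) ∞ B (A (t, 0)) := by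
    rw [hA0]
    have h1 : ContMDiffAt 𝓘(ℝ, EuclideanSpace ℝ (Fin 4)) (𝓡 4) ∞ φ.symm (φ x₀) :=
      (contMDiffOn_extChartAt_symm x₀).contMDiffAt
        ((isOpen_extChartAt_target x₀).mem_nhds (mem_extChartAt_target x₀))
    have h2 : ContMDiffAt (𝓡 4) ((𝓡 1).prod 𝓘(ℝ, EuclideanSpace ℝ (Fin 3))) ∞ D.ν₀.toHomeo.symm
        (φ.symm (φ x₀)) := by
      rw [extChartAt_to_inv]
      exact D.ν₀.contMDiffOn_toHomeo_symm.contMDiffAt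
        (D.ν₀.isOpen_range.mem_nhds ⟨(circlePt t, 0), D.ν₀.apply_zero _⟩)
    have h12 := h2.comp (φ x₀) h1
    have hpt : D.ν₀.toHomeo.symm (φ.symm (φ x₀)) = (circlePt t, 0) := by
      rw [extChartAt_to_inv, hx₀, ← D.ν₀.apply_zero, D.ν₀.toHomeo_symm_apply]
    have h3 : ContMDiffAt ((𝓡 1).prod 𝓘(ℝ, EuclideanSpace ℝ (Fin 3))) 𝓘(ℝ, ℝ × EuclideanSpace ℝ (Fin 3)) ∞
        (fun p : (Metric.sphere (0 : EuclideanSpace ℝ (Fin 2)) 1) × EuclideanSpace ℝ (Fin 3) =>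
          ((ang p.1, p.2) : ℝ × EuclideanSpace ℝ (Fin 3))) (D.ν₀.toHomeo.symm (φ.symm (φ x₀))) := by
      rw [hpt]
      exact (hang.comp (circlePt t, (0 : EuclideanSpace ℝ (Fin 3))) contMDiffAt_fst).prodMk_space contMDiffAt_snd
    have h123 := h3.comp (φ x₀) h12
    have hang0 : ang (circlePt t) = t := hsec.self_of_nhds
    have h4 : ContMDiffAt 𝓘(ℝ, ℝ × EuclideanSpace ℝ (Fin 3)) 𝓘(ℝ, ℝ × EuclideanSpace ℝ (Fin 3)) ∞ D.Ψ₁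
        ((fun p : (Metric.sphere (0 : EuclideanSpace ℝ (Fin 2)) 1) × EuclideanSpace ℝ (Fin 3) =>
          ((ang p.1, p.2) : ℝ × EuclideanSpace ℝ (Fin 3))) (D.ν₀.toHomeo.symm (φ.symm (φ x₀)))) := by
      rw [hpt]
      show ContMDiffAt _ _ ∞ D.Ψ₁ (ang (circlePt t), 0)
      rw [hang0, contMDiffAt_iff_contDiffAt]
      exact D.hΨ₁.contDiffAt ((isOpen_univ.prod isOpen_ball).mem_nhds
        (mk_mem_prod (mem_univ t) (mem_ball_self D.hr₁)))
    exact h4.comp (φ x₀) h123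
  -- `B ∘ A = id` near `(t, 0)`
  have hBA : ∀ᶠ q in 𝓝 ((t, (0 : EuclideanSpace ℝ (Fin 3))) : ℝ × EuclideanSpace ℝ (Fin 3)), B (A q) = q := by
    -- the tube, the chart domain, and the window of the angle section
    have htube : ∀ᶠ q : ℝ × EuclideanSpace ℝ (Fin 3) in 𝓝 (t, 0),
        q ∈ univ ×ˢ ball (0 : EuclideanSpace ℝ (Fin 3)) D.ε₁ :=
      (isOpen_univ.prod isOpen_ball).mem_nhds (mk_mem_prod (mem_univ t) (mem_ball_self D.hε₁))
    have hsrc : ∀ᶠ q : ℝ × EuclideanSpace ℝ (Fin 3) in 𝓝 (t, 0), D.Θ₀ q ∈ φ.source := by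
      have hc : ContinuousAt D.Θ₀ (t, 0) := (D.contMDiffAt_Θ₀ t).continuousAt
      refine hc.preimage_mem_nhds ?_
      rw [h0]; exact extChartAt_source_mem_nhds x₀
    have hwin : ∀ᶠ q : ℝ × EuclideanSpace ℝ (Fin 3) in 𝓝 (t, 0), ang (circlePt (D.Φ₁ q).1) = (D.Φ₁ q).1 := by
      have hc : ContinuousAt (fun q : ℝ × EuclideanSpace ℝ (Fin 3) => (D.Φ₁ q).1) (t, 0) := by
        refine continuousAt_fst.comp ?_
        exact (D.hΦ₁.continuousOn.continuousAt ((isOpen_univ.prod isOpen_ball).mem_nhds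
          (mk_mem_prod (mem_univ t) (mem_ball_self D.hε₁))))
      have ht : (D.Φ₁ (t, 0)).1 = t := by rw [D.hΦ₁0]
      have hc' := hc.tendsto
      simp only [ht] at hc'
      exact hc'.eventually hsec
    filter_upwards [htube, hsrc, hwin] with q hq hqs hqw
    simp only [hA, hB]
    rw [φ.left_inv hqs, Θ₀, D.ν₀.toHomeo_symm_apply]
    simp only [hqw, Prod.mk.eta]
    exact (D.hinv q hq).2
  have key := mfderiv_injective_of_leftInverse hAs hBs hBA
  rwa [mfderiv_eq_fderiv] at key

end TSetup

end BottTube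

end Summit.SmoothPoincare4.SmoothPoincare4.Cruxes.RungOne.Sketch

end
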